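import Mathlib
import Literature.Analysis.FluidPDE.VectorCalculus
import Literature.Analysis.FluidPDE.LeiZhang2011Proofs

/-!
# The honest regime `b < 1` of the normal-variation clause: no switch-off of the Biot–Savart integral

Refutation-first lane `ns-filament-19175-p1` (crux `TransverseReductionR`, stmt-NavierStokesRegularity-19175);
third kernel-checked companion of the desk audit `JUNK-AUDIT-19175.md`.  The junk files
(`FilamentSkeletonRssNormalVariationJunk.lean`, `…JunkDeriv.lean`) show that with growth exponent
`b = 1` the test class of clause 13 contains fields switching the perturbed regularised Biot–Savart
integral off (`u_{X+sY} ≡ 0` for `s ≠ 0`), so that the clause fails by junk.  This file records the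
converse half of the audit's recommendation «witness `SelectionBoxR` with `b < 1`»:

* `integrable_perturbedLine_of_lt_one` — along a straight filament `σ ↦ σ t`, for every `C¹` test
  field with `‖Y σ‖ + ‖Y′ σ‖ ≤ (1 + |σ|)^b`, `b < 1`, and every `|s| ≤ 1/2`, the perturbed integrand
  `(‖y − Z(σ)‖² + 1)^(−3/2) Z′(σ) × (y − Z(σ))`, `Z = σ t + s Y(σ)`, is Bochner integrable at every `y`
  (majorant `C (1 + |σ|)^{b⁺−2}`, `integrable_one_add_norm`), so Lean's `∫` is the genuine field.

Scope: straight filament only (the far tails of a box are where the switch-off lives); the remaining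
half of «junk-free» — differentiability in `s` by dominated convergence — is not formalised here.
Negative-side bookkeeping; NOT a claim about NS regularity or blow-up.
-/

set_option linter.dupNamespace false

noncomputable section

namespace Summit.NavierStokesRegularity.NavierStokesRegularity.Theorems

open Set Function Filter MeasureTheory Real
open Literature.Analysis.FluidPDE
open scoped InnerProductSpace Topology

namespace NormalVariationJunk

/-- Kernel algebra: `(A^{3/2})⁻¹ ‖Δ‖ ≤ A⁻¹` for `A = ‖Δ‖² + 1`. [folklore] -/
theorem kernel_mul_norm_le (Δ : EuclideanSpace ℝ (Fin 3)) :
    ((‖Δ‖ ^ 2 + 1) ^ (3/2:ℝ))⁻¹ * ‖Δ‖ ≤ (‖Δ‖ ^ 2 + 1)⁻¹ := by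
  have hA : 0 < ‖Δ‖ ^ 2 + 1 := by positivity
  have h32 : (‖Δ‖ ^ 2 + 1) ^ (3/2:ℝ) = (‖Δ‖ ^ 2 + 1) * √(‖Δ‖ ^ 2 + 1) := by
    rw [show (3/2:ℝ) = 1 + 1/2 by norm_num, Real.rpow_add hA, Real.rpow_one, Real.sqrt_eq_rpow]
  have hΔle : ‖Δ‖ ≤ √(‖Δ‖ ^ 2 + 1) :=
    calc ‖Δ‖ = √(‖Δ‖ ^ 2) := (Real.sqrt_sq (norm_nonneg _)).symm
      _ ≤ √(‖Δ‖ ^ 2 + 1) := Real.sqrt_le_sqrt (by linarith)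
  have hs : 0 < √(‖Δ‖ ^ 2 + 1) := Real.sqrt_pos.2 hA
  calc ((‖Δ‖ ^ 2 + 1) ^ (3/2:ℝ))⁻¹ * ‖Δ‖ ≤ ((‖Δ‖ ^ 2 + 1) ^ (3/2:ℝ))⁻¹ * √(‖Δ‖ ^ 2 + 1) := by
        gcongr
    _ = (‖Δ‖ ^ 2 + 1)⁻¹ := by rw [h32]; field_simp

/-- **No switch-off below `b = 1`.** Along the straight filament `σ ↦ σ t` (`‖t‖ = 1`), for a `C¹`
test field with `‖Y σ‖ + ‖Y′ σ‖ ≤ (1 + |σ|)^b`, `b < 1`, and `|s| ≤ 1/2`, the regularised Biot–Savart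
integrand of the perturbed filament `Z = σ t + s Y(σ)` IS Bochner integrable at every point `y`
(majorant `C (1 + |σ|)^{b⁺ − 2}`): the switch-off of `not_integrable_perturbedLine` needs `b ≥ 1`.
Kernel-checked half of «clause 13 is junk-free for `b < 1`» (JUNK-AUDIT-19175 §1; the other half is
dominated differentiation in `s`). [folklore] -/
theorem integrable_perturbedLine_of_lt_one (t y : EuclideanSpace ℝ (Fin 3)) (ht : ‖t‖ = 1) {b : ℝ}
    (hb : b < 1) (Y : ℝ → EuclideanSpace ℝ (Fin 3)) (hY : ContDiff ℝ 1 Y)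
    (hYb : ∀ σ, ‖Y σ‖ + ‖deriv Y σ‖ ≤ (1 + |σ|) ^ b) {s : ℝ} (hs : |s| ≤ 1/2) :
    Integrable (fun σ : ℝ => ((‖y - (σ • t + s • Y σ)‖ ^ 2 + 1) ^ (3/2:ℝ))⁻¹ •
      cross (deriv (fun σ : ℝ => σ • t + s • Y σ) σ) (y - (σ • t + s • Y σ))) := by
  set B : ℝ := max b 0 with hB
  have hB1 : B < 1 := max_lt hb one_pos
  have hB0 : 0 ≤ B := le_max_right _ _
  have hYd : Differentiable ℝ Y := hY.differentiable one_ne_zero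
  have hYB : ∀ σ, ‖Y σ‖ + ‖deriv Y σ‖ ≤ (1 + |σ|) ^ B := fun σ =>
    (hYb σ).trans (Real.rpow_le_rpow_of_exponent_le (by linarith [abs_nonneg σ]) (le_max_left _ _))
  have hYlin : ∀ σ, ‖Y σ‖ + ‖deriv Y σ‖ ≤ 1 + |σ| := fun σ =>
    (hYB σ).trans (by
      calc (1 + |σ|) ^ B ≤ (1 + |σ|) ^ (1:ℝ) :=
            Real.rpow_le_rpow_of_exponent_le (by linarith [abs_nonneg σ]) hB1.le
        _ = 1 + |σ| := Real.rpow_one _)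
  have hZ' : ∀ σ, deriv (fun σ : ℝ => σ • t + s • Y σ) σ = t + s • deriv Y σ := fun σ => by
    have h1 : HasDerivAt (fun σ : ℝ => σ • t) ((1:ℝ) • t) σ := (hasDerivAt_id' σ).smul_const t
    have h2 : HasDerivAt (fun σ : ℝ => s • Y σ) (s • deriv Y σ) σ := (hYd σ).hasDerivAt.const_smul s
    rw [(h1.fun_add h2).deriv, one_smul]
  set R₀ : ℝ := 4 * ‖y‖ + 2 with hR₀
  set C : ℝ := 2 * (1 + R₀) ^ 2 + 64 with hC
  have hmaj : Integrable (fun σ : ℝ => C * (1 + ‖σ‖) ^ (-(2 - B))) :=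
    (integrable_one_add_norm (by rw [Module.finrank_self]; push_cast; linarith)).const_mul C
  refine hmaj.mono' ?_ (Eventually.of_forall fun σ => ?_)
  · have hZc : Continuous fun σ : ℝ => σ • t + s • Y σ := by
      have := hY.continuous; fun_prop
    have hdc : Continuous fun σ : ℝ => t + s • deriv Y σ := by
      have := hY.continuous_deriv le_rfl; fun_prop
    have hK : Continuous fun σ : ℝ => ((‖y - (σ • t + s • Y σ)‖ ^ 2 + 1) ^ (3/2:ℝ))⁻¹ := by
      have h1 : Continuous fun σ : ℝ => (‖y - (σ • t + s • Y σ)‖ ^ 2 + 1) ^ (3/2:ℝ) :=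
        (by fun_prop : Continuous fun σ : ℝ => ‖y - (σ • t + s • Y σ)‖ ^ 2 + 1).rpow_const
          fun σ => Or.inr (by norm_num)
      exact h1.inv₀ fun σ => (Real.rpow_pos_of_pos (by positivity) _).ne'
    have hcr : Continuous fun σ : ℝ => cross (t + s • deriv Y σ) (y - (σ • t + s • Y σ)) :=
      crossCLM.continuous₂.comp (hdc.prodMk (continuous_const.sub hZc))
    have h := hK.smul hcr
    refine (Continuous.aestronglyMeasurable ?_)
    simp_rw [hZ']
    exact h
  · rw [hZ']
    set Δ := y - (σ • t + s • Y σ) with hΔ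
    have hA : 0 < ‖Δ‖ ^ 2 + 1 := by positivity
    have hK : 0 < ((‖Δ‖ ^ 2 + 1) ^ (3/2:ℝ))⁻¹ := inv_pos.2 (Real.rpow_pos_of_pos hA _)
    have hx1 : 1 ≤ 1 + |σ| := by linarith [abs_nonneg σ]
    have hpowB : 1 ≤ (1 + |σ|) ^ B := Real.one_le_rpow hx1 hB0
    -- the tangent is at most `2 (1+|σ|)^B`
    have hZn : ‖t + s • deriv Y σ‖ ≤ 2 * (1 + |σ|) ^ B := by
      calc ‖t + s • deriv Y σ‖ ≤ ‖t‖ + ‖s • deriv Y σ‖ := norm_add_le _ _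
        _ = 1 + |s| * ‖deriv Y σ‖ := by rw [ht, norm_smul, Real.norm_eq_abs]
        _ ≤ 1 + 1/2 * (1 + |σ|) ^ B := by
            gcongr
            linarith [hYB σ, norm_nonneg (Y σ)]
        _ ≤ 2 * (1 + |σ|) ^ B := by linarith
    -- first bound: ‖F‖ ≤ ‖Z′‖ / (‖Δ‖² + 1)
    have hF : ‖((‖Δ‖ ^ 2 + 1) ^ (3/2:ℝ))⁻¹ • cross (t + s • deriv Y σ) Δ‖ ≤
        2 * (1 + |σ|) ^ B * (‖Δ‖ ^ 2 + 1)⁻¹ := by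
      rw [norm_smul, Real.norm_eq_abs, abs_of_pos hK]
      calc ((‖Δ‖ ^ 2 + 1) ^ (3/2:ℝ))⁻¹ * ‖cross (t + s • deriv Y σ) Δ‖
          ≤ ((‖Δ‖ ^ 2 + 1) ^ (3/2:ℝ))⁻¹ * (‖t + s • deriv Y σ‖ * ‖Δ‖) := by
            gcongr; exact norm_cross_le_norm_mul_norm _ _
        _ = ‖t + s • deriv Y σ‖ * (((‖Δ‖ ^ 2 + 1) ^ (3/2:ℝ))⁻¹ * ‖Δ‖) := by ring
        _ ≤ 2 * (1 + |σ|) ^ B * (‖Δ‖ ^ 2 + 1)⁻¹ :=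
            mul_le_mul hZn (kernel_mul_norm_le Δ) (by positivity) (by positivity)
    -- the majorant in the form `C (1+|σ|)^B / (1+|σ|)^2`
    have hg : C * (1 + ‖σ‖) ^ (-(2 - B)) = C * (1 + |σ|) ^ B / (1 + |σ|) ^ 2 := by
      rw [Real.norm_eq_abs, show -(2 - B) = B - 2 by ring, Real.rpow_sub (by linarith), mul_div_assoc]
      norm_cast
    rw [hg]
    refine hF.trans ?_
    by_cases hσ : |σ| ≤ R₀
    · -- near part: `(‖Δ‖²+1)⁻¹ ≤ 1` and `(1+|σ|)² ≤ (1+R₀)²`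
      have h1 : (‖Δ‖ ^ 2 + 1)⁻¹ ≤ 1 := inv_le_one_of_one_le₀ (by nlinarith [norm_nonneg Δ])
      have h2 : (1 + |σ|) ^ 2 ≤ (1 + R₀) ^ 2 := by gcongr
      have h3 : 0 < (1 + |σ|) ^ 2 := by positivity
      rw [le_div_iff₀ h3]
      calc 2 * (1 + |σ|) ^ B * (‖Δ‖ ^ 2 + 1)⁻¹ * (1 + |σ|) ^ 2
          ≤ 2 * (1 + |σ|) ^ B * 1 * (1 + R₀) ^ 2 := by gcongr
        _ ≤ C * (1 + |σ|) ^ B := by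
            rw [hC]; nlinarith [hpowB, sq_nonneg (1 + R₀)]
    · -- far part: `‖Δ‖ ≥ |σ|/4`, so `‖Δ‖² + 1 ≥ (1+|σ|)²/32`
      have hσ' : R₀ < |σ| := not_le.1 hσ
      have hΔlow : |σ| / 4 ≤ ‖Δ‖ := by
        have h1 : ‖σ • t + s • Y σ‖ - ‖y‖ ≤ ‖Δ‖ := by
          rw [hΔ, norm_sub_rev]; exact norm_sub_norm_le _ _
        have h2 : ‖σ • t‖ ≤ ‖σ • t + s • Y σ‖ + ‖s • Y σ‖ := by
          have := norm_sub_le (σ • t + s • Y σ) (s • Y σ); rwa [add_sub_cancel_right] at this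
        have h3 : ‖σ • t‖ = |σ| := by rw [norm_smul, Real.norm_eq_abs, ht, mul_one]
        have h4 : ‖s • Y σ‖ ≤ 1/2 * (1 + |σ|) := by
          rw [norm_smul, Real.norm_eq_abs]
          exact mul_le_mul hs (by linarith [hYlin σ, norm_nonneg (deriv Y σ)]) (norm_nonneg _)
            (by norm_num)
        rw [hR₀] at hσ'
        linarith
      have hden : (1 + |σ|) ^ 2 / 32 ≤ ‖Δ‖ ^ 2 + 1 := by
        have h0 : 0 ≤ |σ| / 4 := by positivity
        have h1 : (|σ| / 4) ^ 2 ≤ ‖Δ‖ ^ 2 := pow_le_pow_left₀ h0 hΔlow 2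
        nlinarith [abs_nonneg σ]
      have h3 : 0 < (1 + |σ|) ^ 2 := by positivity
      rw [le_div_iff₀ h3]
      calc 2 * (1 + |σ|) ^ B * (‖Δ‖ ^ 2 + 1)⁻¹ * (1 + |σ|) ^ 2
          ≤ 2 * (1 + |σ|) ^ B * ((1 + |σ|) ^ 2 / 32)⁻¹ * (1 + |σ|) ^ 2 := by
            gcongr
        _ = 64 * (1 + |σ|) ^ B := by field_simp; norm_num
        _ ≤ C * (1 + |σ|) ^ B := by rw [hC]; gcongr; nlinarith [sq_nonneg (1 + R₀)]

/-! ### No jump at `s = 0` below `b = 1` (appended 2026-08-27, same lane) -/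

/-- Uniform majorant behind `integrable_perturbedLine_of_lt_one`: for `|s| ≤ 1/2` the perturbed integrand
is bounded by `(2(1+R₀)² + 64)(1+|σ|)^{b⁺−2}`, `R₀ = 4‖y‖ + 2`, uniformly in `s`. [folklore] -/
theorem norm_perturbedLine_integrand_le (t y : EuclideanSpace ℝ (Fin 3)) (ht : ‖t‖ = 1) {b : ℝ}
    (hb : b < 1) (Y : ℝ → EuclideanSpace ℝ (Fin 3)) (hY : ContDiff ℝ 1 Y)
    (hYb : ∀ σ, ‖Y σ‖ + ‖deriv Y σ‖ ≤ (1 + |σ|) ^ b) {s : ℝ} (hs : |s| ≤ 1/2) (σ : ℝ) :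
    ‖((‖y - (σ • t + s • Y σ)‖ ^ 2 + 1) ^ (3/2:ℝ))⁻¹ •
      cross (deriv (fun σ : ℝ => σ • t + s • Y σ) σ) (y - (σ • t + s • Y σ))‖ ≤
      (2 * (1 + (4 * ‖y‖ + 2)) ^ 2 + 64) * (1 + ‖σ‖) ^ (-(2 - max b 0)) := by
  set B : ℝ := max b 0 with hB
  have hB1 : B < 1 := max_lt hb one_pos
  have hB0 : 0 ≤ B := le_max_right _ _
  have hYd : Differentiable ℝ Y := hY.differentiable one_ne_zero
  have hYB : ‖Y σ‖ + ‖deriv Y σ‖ ≤ (1 + |σ|) ^ B :=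
    (hYb σ).trans (Real.rpow_le_rpow_of_exponent_le (by linarith [abs_nonneg σ]) (le_max_left _ _))
  have hYlin : ‖Y σ‖ + ‖deriv Y σ‖ ≤ 1 + |σ| :=
    hYB.trans (by
      calc (1 + |σ|) ^ B ≤ (1 + |σ|) ^ (1:ℝ) :=
            Real.rpow_le_rpow_of_exponent_le (by linarith [abs_nonneg σ]) hB1.le
        _ = 1 + |σ| := Real.rpow_one _)
  have hZ' : deriv (fun σ : ℝ => σ • t + s • Y σ) σ = t + s • deriv Y σ := by
    have h1 : HasDerivAt (fun σ : ℝ => σ • t) ((1:ℝ) • t) σ := (hasDerivAt_id' σ).smul_const t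
    have h2 : HasDerivAt (fun σ : ℝ => s • Y σ) (s • deriv Y σ) σ := (hYd σ).hasDerivAt.const_smul s
    rw [(h1.fun_add h2).deriv, one_smul]
  set R₀ : ℝ := 4 * ‖y‖ + 2 with hR₀
  set C : ℝ := 2 * (1 + R₀) ^ 2 + 64 with hC
  rw [hZ']
  set Δ := y - (σ • t + s • Y σ) with hΔ
  have hA : 0 < ‖Δ‖ ^ 2 + 1 := by positivity
  have hK : 0 < ((‖Δ‖ ^ 2 + 1) ^ (3/2:ℝ))⁻¹ := inv_pos.2 (Real.rpow_pos_of_pos hA _)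
  have hx1 : 1 ≤ 1 + |σ| := by linarith [abs_nonneg σ]
  have hpowB : 1 ≤ (1 + |σ|) ^ B := Real.one_le_rpow hx1 hB0
  have hZn : ‖t + s • deriv Y σ‖ ≤ 2 * (1 + |σ|) ^ B := by
    calc ‖t + s • deriv Y σ‖ ≤ ‖t‖ + ‖s • deriv Y σ‖ := norm_add_le _ _
      _ = 1 + |s| * ‖deriv Y σ‖ := by rw [ht, norm_smul, Real.norm_eq_abs]
      _ ≤ 1 + 1/2 * (1 + |σ|) ^ B := by
          gcongr
          linarith [norm_nonneg (Y σ)]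
      _ ≤ 2 * (1 + |σ|) ^ B := by linarith
  have hF : ‖((‖Δ‖ ^ 2 + 1) ^ (3/2:ℝ))⁻¹ • cross (t + s • deriv Y σ) Δ‖ ≤
      2 * (1 + |σ|) ^ B * (‖Δ‖ ^ 2 + 1)⁻¹ := by
    rw [norm_smul, Real.norm_eq_abs, abs_of_pos hK]
    calc ((‖Δ‖ ^ 2 + 1) ^ (3/2:ℝ))⁻¹ * ‖cross (t + s • deriv Y σ) Δ‖
        ≤ ((‖Δ‖ ^ 2 + 1) ^ (3/2:ℝ))⁻¹ * (‖t + s • deriv Y σ‖ * ‖Δ‖) := by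
          gcongr; exact norm_cross_le_norm_mul_norm _ _
      _ = ‖t + s • deriv Y σ‖ * (((‖Δ‖ ^ 2 + 1) ^ (3/2:ℝ))⁻¹ * ‖Δ‖) := by ring
      _ ≤ 2 * (1 + |σ|) ^ B * (‖Δ‖ ^ 2 + 1)⁻¹ :=
          mul_le_mul hZn (kernel_mul_norm_le Δ) (by positivity) (by positivity)
  have hg : C * (1 + ‖σ‖) ^ (-(2 - B)) = C * (1 + |σ|) ^ B / (1 + |σ|) ^ 2 := by
    rw [Real.norm_eq_abs, show -(2 - B) = B - 2 by ring, Real.rpow_sub (by linarith), mul_div_assoc]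
    norm_cast
  rw [hg]
  refine hF.trans ?_
  by_cases hσ : |σ| ≤ R₀
  · have h1 : (‖Δ‖ ^ 2 + 1)⁻¹ ≤ 1 := inv_le_one_of_one_le₀ (by nlinarith [norm_nonneg Δ])
    have h2 : (1 + |σ|) ^ 2 ≤ (1 + R₀) ^ 2 := by gcongr
    have h3 : 0 < (1 + |σ|) ^ 2 := by positivity
    rw [le_div_iff₀ h3]
    calc 2 * (1 + |σ|) ^ B * (‖Δ‖ ^ 2 + 1)⁻¹ * (1 + |σ|) ^ 2
        ≤ 2 * (1 + |σ|) ^ B * 1 * (1 + R₀) ^ 2 := by gcongr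
      _ ≤ C * (1 + |σ|) ^ B := by
          rw [hC]; nlinarith [hpowB, sq_nonneg (1 + R₀)]
  · have hσ' : R₀ < |σ| := not_le.1 hσ
    have hΔlow : |σ| / 4 ≤ ‖Δ‖ := by
      have h1 : ‖σ • t + s • Y σ‖ - ‖y‖ ≤ ‖Δ‖ := by
        rw [hΔ, norm_sub_rev]; exact norm_sub_norm_le _ _
      have h2 : ‖σ • t‖ ≤ ‖σ • t + s • Y σ‖ + ‖s • Y σ‖ := by
        have := norm_sub_le (σ • t + s • Y σ) (s • Y σ); rwa [add_sub_cancel_right] at this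
      have h3 : ‖σ • t‖ = |σ| := by rw [norm_smul, Real.norm_eq_abs, ht, mul_one]
      have h4 : ‖s • Y σ‖ ≤ 1/2 * (1 + |σ|) := by
        rw [norm_smul, Real.norm_eq_abs]
        exact mul_le_mul hs (by linarith [norm_nonneg (deriv Y σ)]) (norm_nonneg _) (by norm_num)
      rw [hR₀] at hσ'
      linarith
    have hden : (1 + |σ|) ^ 2 / 32 ≤ ‖Δ‖ ^ 2 + 1 := by
      have h0 : 0 ≤ |σ| / 4 := by positivity
      have h1 : (|σ| / 4) ^ 2 ≤ ‖Δ‖ ^ 2 := pow_le_pow_left₀ h0 hΔlow 2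
      nlinarith [abs_nonneg σ]
    have h3 : 0 < (1 + |σ|) ^ 2 := by positivity
    rw [le_div_iff₀ h3]
    calc 2 * (1 + |σ|) ^ B * (‖Δ‖ ^ 2 + 1)⁻¹ * (1 + |σ|) ^ 2
        ≤ 2 * (1 + |σ|) ^ B * ((1 + |σ|) ^ 2 / 32)⁻¹ * (1 + |σ|) ^ 2 := by
          gcongr
      _ = 64 * (1 + |σ|) ^ B := by field_simp; norm_num
      _ ≤ C * (1 + |σ|) ^ B := by rw [hC]; gcongr; nlinarith [sq_nonneg (1 + R₀)]

/-- **No jump at `s = 0` below `b = 1`.** For `b < 1` the perturbed regularised Biot–Savart integral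
`s ↦ ∫ (‖y − Z_s(σ)‖² + 1)^(−3/2) Z_s′(σ) × (y − Z_s(σ)) dσ`, `Z_s = σ t + s Y(σ)`, is CONTINUOUS at
`s = 0` (dominated convergence with the majorant of `norm_perturbedLine_integrand_le`): the jump that
drives the junk derivative for `b ≥ 1` (`deriv_T_eq_zero_of_junk`) does not occur. [folklore] -/
theorem continuousAt_perturbedLine_integral_of_lt_one (t y : EuclideanSpace ℝ (Fin 3)) (ht : ‖t‖ = 1)
    {b : ℝ} (hb : b < 1) (Y : ℝ → EuclideanSpace ℝ (Fin 3)) (hY : ContDiff ℝ 1 Y)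
    (hYb : ∀ σ, ‖Y σ‖ + ‖deriv Y σ‖ ≤ (1 + |σ|) ^ b) :
    ContinuousAt (fun s : ℝ => ∫ σ : ℝ, ((‖y - (σ • t + s • Y σ)‖ ^ 2 + 1) ^ (3/2:ℝ))⁻¹ •
      cross (deriv (fun σ : ℝ => σ • t + s • Y σ) σ) (y - (σ • t + s • Y σ))) 0 := by
  set B : ℝ := max b 0 with hB
  have hB1 : B < 1 := max_lt hb one_pos
  have hYd : Differentiable ℝ Y := hY.differentiable one_ne_zero
  have hYc : Continuous Y := hY.continuous
  have hY'c : Continuous (deriv Y) := hY.continuous_deriv le_rfl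
  have hZ' : ∀ s σ : ℝ, deriv (fun σ : ℝ => σ • t + s • Y σ) σ = t + s • deriv Y σ := fun s σ => by
    have h1 : HasDerivAt (fun σ : ℝ => σ • t) ((1:ℝ) • t) σ := (hasDerivAt_id' σ).smul_const t
    have h2 : HasDerivAt (fun σ : ℝ => s • Y σ) (s • deriv Y σ) σ := (hYd σ).hasDerivAt.const_smul s
    rw [(h1.fun_add h2).deriv, one_smul]
  have hball : Metric.closedBall (0:ℝ) (1/2) ∈ 𝓝 (0:ℝ) := Metric.closedBall_mem_nhds 0 (by norm_num)
  have hsmall : ∀ s ∈ Metric.closedBall (0:ℝ) (1/2), |s| ≤ 1/2 := fun s hs => by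
    simpa [Real.dist_eq] using Metric.mem_closedBall.1 hs
  have hmaj : Integrable (fun σ : ℝ => (2 * (1 + (4 * ‖y‖ + 2)) ^ 2 + 64) * (1 + ‖σ‖) ^ (-(2 - max b 0))) :=
    (integrable_one_add_norm (by rw [Module.finrank_self]; push_cast; linarith)).const_mul _
  -- continuity of the integrand in `σ` for fixed `s`, and in `s` for fixed `σ`
  have hmeas : ∀ s : ℝ, Continuous fun σ : ℝ => ((‖y - (σ • t + s • Y σ)‖ ^ 2 + 1) ^ (3/2:ℝ))⁻¹ •
      cross (t + s • deriv Y σ) (y - (σ • t + s • Y σ)) := fun s => by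
    have hZc : Continuous fun σ : ℝ => σ • t + s • Y σ := by fun_prop
    have hdc : Continuous fun σ : ℝ => t + s • deriv Y σ := by fun_prop
    have hK : Continuous fun σ : ℝ => ((‖y - (σ • t + s • Y σ)‖ ^ 2 + 1) ^ (3/2:ℝ))⁻¹ := by
      have h1 : Continuous fun σ : ℝ => (‖y - (σ • t + s • Y σ)‖ ^ 2 + 1) ^ (3/2:ℝ) :=
        (by fun_prop : Continuous fun σ : ℝ => ‖y - (σ • t + s • Y σ)‖ ^ 2 + 1).rpow_const
          fun σ => Or.inr (by norm_num)
      exact h1.inv₀ fun σ => (Real.rpow_pos_of_pos (by positivity) _).ne'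
    exact hK.smul (crossCLM.continuous₂.comp (hdc.prodMk (continuous_const.sub hZc)))
  have hcs : ∀ σ : ℝ, Continuous fun s : ℝ => ((‖y - (σ • t + s • Y σ)‖ ^ 2 + 1) ^ (3/2:ℝ))⁻¹ •
      cross (t + s • deriv Y σ) (y - (σ • t + s • Y σ)) := fun σ => by
    have hZc : Continuous fun s : ℝ => σ • t + s • Y σ := by fun_prop
    have hdc : Continuous fun s : ℝ => t + s • deriv Y σ := by fun_prop
    have hK : Continuous fun s : ℝ => ((‖y - (σ • t + s • Y σ)‖ ^ 2 + 1) ^ (3/2:ℝ))⁻¹ := by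
      have h1 : Continuous fun s : ℝ => (‖y - (σ • t + s • Y σ)‖ ^ 2 + 1) ^ (3/2:ℝ) :=
        (by fun_prop : Continuous fun s : ℝ => ‖y - (σ • t + s • Y σ)‖ ^ 2 + 1).rpow_const
          fun s => Or.inr (by norm_num)
      exact h1.inv₀ fun s => (Real.rpow_pos_of_pos (by positivity) _).ne'
    exact hK.smul (crossCLM.continuous₂.comp (hdc.prodMk (continuous_const.sub hZc)))
  have hfun : (fun s : ℝ => ∫ σ : ℝ, ((‖y - (σ • t + s • Y σ)‖ ^ 2 + 1) ^ (3/2:ℝ))⁻¹ •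
      cross (deriv (fun σ : ℝ => σ • t + s • Y σ) σ) (y - (σ • t + s • Y σ))) =
      fun s : ℝ => ∫ σ : ℝ, ((‖y - (σ • t + s • Y σ)‖ ^ 2 + 1) ^ (3/2:ℝ))⁻¹ •
      cross (t + s • deriv Y σ) (y - (σ • t + s • Y σ)) := by
    funext s; simp_rw [hZ' s]
  rw [hfun]
  refine continuousAt_of_dominated (Eventually.of_forall fun s => (hmeas s).aestronglyMeasurable) ?_ hmaj
    (Eventually.of_forall fun σ => (hcs σ).continuousAt)
  filter_upwards [hball] with s hs
  refine Eventually.of_forall fun σ => ?_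
  have h := norm_perturbedLine_integrand_le t y ht hb Y hY hYb (hsmall s hs) σ
  rwa [hZ' s σ] at h

end NormalVariationJunk

end Summit.NavierStokesRegularity.NavierStokesRegularity.Theorems
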